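import Mathlib
import HarnessLib
import HarnessLib.Audit
import Summits.AtomisticToContinuum.Statement
import Literature.MathematicalPhysics.QuantumManyBody.PeriodicBoseGas
import Literature.MathematicalPhysics.QuantumManyBody.PeriodicBoseGasFourier
import HarnessLib.Audit.Status.Attr

/-!
Route: BECConjugateDomination

DORMANT since 2026-08-24T23:45:32Z (reconciler: no traction for 7.2 d (last activity item-evidence-added at 2026-08-17T18:55:01Z); parked, not closed — `ledger route dormant route-AtomisticToContinuum-BECConjugateDomination --off` to re) — unstaffed, not closed; items shared with open routes are served there. `ledger route dormant <id> --off` reactivates.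

# Route BECConjugateDomination — phase Lévy weight × structure factor ≤ C plus the Puff floor give
torus BEC, no n₀ anywhere

It suffices to show X = InfraredMinimumUncertainty ∧ PuffFloor for the POSITIVE MINIMISER Ψ of the
periodic N-body energy on the torus of
side L = (N/ρ)^{1/3}, for every potential of the smooth class (repulsive, finite, finite range, C²
as ṽ(x) = v(|x|), edge condition
‖D²ṽ‖ ≤ Cₑ√ṽ), at all small ρ and all large N; the shared crux BoundaryTransferWeak (torus →
Dirichlet, stmt-0827, open in two other routes) and HardCoreExtension
(smooth class → every repulsive finite-range v; the statement of retired stmt-6737, re-filed) then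
carry it to the conjunct. Objects, all read off the SAME state and with no
condensate fraction anywhere: g(r) = ∫_cell dx ∫ dY Ψ(x+r,Y)Ψ(x,Y) (translation-averaged one-body
density matrix /ρ, g(0) = 1), its Lévy
weights ν_m = Re ĉ_m(log g) (cell Fourier coefficients, m ∈ ℤ³∖0, k = 2πm/L), the static structure
factor S_m = N⁻¹⟨|Σ_j e^{ik·x_j}|²⟩.
InfraredMinimumUncertainty (IMU; card infrared-minimum-uncertainty-quarter K1 in its load-bearing
bounded form): Π_m := N·ν_m·S_m ≤ C(v) for
EVERY m ≠ 0, uniformly in N and in ρ < ρ₀ (Bogoliubov: C = ¼ at every k; Gavoret–Nozières: Π → ¼ as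
k → 0). PuffFloor (card P1′(a)):
S_m ≥ |k|/√(|k|² + Cρ). Successor of route BECInfraredUncertainty (retired 2026-08-15 `not-a-thesis`
only for lack of a deciding theorem;
same mechanism, now thin: 4 cruxes, the sharp QuarterLaw kept as the falsifier, and `closes … :
BoseEinsteinCondensation` certified).
Lean: `InfraredMinimumUncertainty ∧ PuffFloor`

## Assembly
Pure logic, and this time certified: the DECIDING THEOREM (glue.lean, D-0027 §2.1) is
`theorem closes (h₁ : InfraredMinimumUncertainty) (h₂ : PuffFloor) (h₃ : BoundaryTransferWeak) (h₄ :
HardCoreExtension) (h₅ : PositiveMinimiser)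
(h₆ : NearMinimiserStability) (h₇ : ShortDistanceCoherence) (h₈ : IMUChainGlue) :
BoseEinsteinCondensation := h₄ (fun v a b c d => h₃ v a (h₈ h₅ h₆ h₇ h₂ h₁ v a b c d))`
(rc 0 in Sketch.lean, axioms propext / Classical.choice / Quot.sound; conclusion = the audited
sub-problem Statement decl `BoseEinsteinCondensation`, by
name): the five mechanism statements feed IMUChainGlue, which yields SmoothPeriodicBEC; for a class
potential v its body is exactly the hypothesis of
BoundaryTransferWeak v, giving HasGroundStateBEC v ρ for small ρ; HardCoreExtension turns the
class-restricted conclusion into the conjunct.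

Rationale: WHY THIS LINE. Every T = 0 route needs an upper bound on infrared phase fluctuations; the classical
tool (Pitaevskii–Stringari uncertainty inequality
n(q) ≥ n₀/4S(q) − ½, Stringari1995 §2.2 (9)–(11); PitaevskiiStringari1991; Gavoret–Nozières pole
sharing, GavoretNozieres1964 via Griffin1993
§6.3) is a LOWER bound with n₀ inside. IMU is its converse typed on a new pair of variables — the
Lévy weight ν_k of log g (MoraCastin2003 §4.3:
ν_k = v_k²/N at Bogoliubov order) against the structure factor of the same state — so that n₀
cancels: Bogoliubov gives the closed form
Π(x) = 1/[2(2+x)(1+x+√(x²+2x))] ↑ ¼ (x = ε_k/gn), phonon saturation gives Π → ¼ in any superfluid,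
and the card's 56 exact ground states (2D/3D
hard-core ED, Bose–Hubbard rings, XX chain to L = 256: Π₁ = 0.24583, 0.24791, 0.24896) never exceed
¼. The second input runs the sum-rule school
as a LOWER bound on S: m₀ ≥ m₁^{3/2}m₃^{−1/2} with the f-sum rule and Puff's cubic moment (Puff1965;
doi:10.1103/physrevb.46.2974; Stringari1995
§2.3 (20)–(23); Feynman1954) gives S ≥ |k|/√(|k|²+Θ), Θ = O(ρ), with no condensate assumed. Imported
areas: moment problems / sum rules of
many-body linear response; Lévy–Khintchine bookkeeping and harmonic analysis on the 3-torus (Jensen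
+ Parseval against a positive-definite
compactly supported kernel); exact-diagonalisation evidence. What it does that open routes do not:
BECInfraredBound / BECPhononFloor bound or
order OCCUPATIONS n_k; BECInfDivCoherence needs the SIGN of ν (infinite divisibility); here the
whole infrared difficulty is one dimensionless,
n₀-free, sign-free inequality between two measurable spectra of one state, and the d-dependence sits
in the single lattice sum Σ_{m≠0} φ̂(k)/|k|
(finite iff d ≥ 2). Negatives index (6 in the summit, 1 in this sub: stmt-3980, an unguarded
constant sign at N = 1) steered around: every
constant is ∃-quantified with its sign and every many-body claim sits under ∀ᶠ N.

RANKED CRUXES. #0 SmoothPeriodicBEC (target) — (verbatim the statement of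
stmt-AtomisticToContinuum-6733 of the retired route BECSumRuleBootstrap, re-filed) PeriodicBEC
restricted to the smooth class: for every repulsive finite-range v that is finite, C² as ṽ(x) =
v(|x|) on ℝ³, with ‖D²ṽ‖ ≤ Cₑ√ṽ, there is ρ₀ > 0 such that for 0 < ρ < ρ₀ there is c > 0 with: for
all large N there is δ > 0 such that every periodic trial state on the torus of side (N/ρ)^{1/3}
with periodicEnergy ≤ E₀^per + δ has constant-mode occupation ≥ cN. It is what X delivers through
IMUChainGlue. (why it might fail: contains thermodynamic-limit BEC for smooth potentials (LSSY2005
Ch. 5: open; Fournais2020 / arXiv:2603.20776 stop at L ≲ a(ρa³)^(−3/4−η)).) [LSSY2005, Fournais2020,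
arXiv:2603.20776, arXiv:2510.20493]
#2 InfraredMinimumUncertainty (crux) — (card K1, bounded load-bearing form, all modes) for every
smooth-class v there are C ≥ 0 and ρ₀ > 0 such that for 0 < ρ < ρ₀, all large N = n+1 and every
positive minimiser Ψ of the periodic N-body energy on the torus of side L = (N/ρ)^{1/3}
(periodicEnergy = E₀^per < ∞, Ψ > 0 pointwise), for every m ∈ ℤ³∖0: N·ν_m·S_m ≤ C, where g(r) =
∫_cell∫_{cell^n} Ψ(x+r,Y)Ψ(x,Y), ν_m = Re cellFourierCoeff(log g)(m), S_m = N⁻¹∫|Σ_j e_m(x_j)|²Ψ².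
Bogoliubov: C = ¼ works at every k; Gavoret–Nozières + phonon saturation of S: Π → ¼ as k → 0; v ≡
0: g ≡ 1, ν = 0, holds with C = 0. [difficulty: open-problem] (why it might fail: it is an n₀-free
infrared bound (ν_k ≲ mc/2N|k| wherever S is linear): as hard as the 1/|k| law for n_k; non-phonon
gapless modes, or a log L dressing of ν_k at the lowest modes beyond Bogoliubov order
(Gavoret–Nozières/Nepomnyashchii territory), would break uniformity in N.) [Stringari1995,
PitaevskiiStringari1991, GavoretNozieres1964, Griffin1993, MoraCastin2003,
NepomnyashchiiNepomnyashchii1978,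
Literature.Barriers.AtomisticToContinuum.BogoliubovPerturbationInfrared]
#3 PuffFloor (crux) — (card P1′(a), linear anti-hyperuniformity floor) for every smooth-class v
there are C ≥ 0, ρ₀ > 0 such that for 0 < ρ < ρ₀, all large N and every positive minimiser Ψ on the
torus of side (N/ρ)^{1/3}, for every m ≠ 0 with k = 2πm/L: S_m ≥ |k|/√(|k|² + Cρ). Intended proof:
m₀ ≥ m₁^{3/2}M₃^{−1/2} (Hölder twice on the spectral measure of H − E₀ in the vector ρ_k†Ψ, which is
supported on [0,∞) because Ψ is the minimiser), f-sum m₁ = N|k|² (units ħ = 2m = 1), and Puff's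
cubic moment M₃ ≤ N|k|⁴(|k|² + c₁T/N + c₂E_Ψ[Σ_{i<j}|x_i−x_j|²|D²ṽ(x_i−x_j)|]/N) with both brackets
O(ρ) (edge condition + energy); Bogoliubov: C = 16πa; v ≡ 0: S_m = 1. [difficulty: L] (why it might
fail: the potential part of m₃ needs a no-clustering bound E[#pairs with |xᵢ−xⱼ|<R₀] ≤ C·NρR₀³ for
the minimiser; the energy controls only ∫vg₂, not pairs in the soft edge of supp v, so Θ = O(ρ) may
need a number-variance input.) [Puff1965, doi:10.1103/physrevb.46.2974, Stringari1995, Feynman1954,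
LSSY2005]
#4 BoundaryTransferWeak (crux) — (shared verbatim with stmt-AtomisticToContinuum-0827, routes
BECInfDivCoherence / BECPhononFloor) for each repulsive finite-range v, PeriodicBEC(v) implies ∃ρ₀>0
∀ρ∈(0,ρ₀) HasGroundStateBEC v ρ (Dirichlet ground state, mode-free λ_max via condensateNumber);
expected proof: Neumann bracketing of interior sub-boxes + λ_max(γ) ≥ tr γ²/N; v ≡ 0: hypothesis and
conclusion both true. [difficulty: L] (why it might fail: PeriodicBEC(v) is ground-state-only (δ
after N); the Dirichlet ground state lies a wall term ≫ δ above E₀^per, so no energy-comparison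
proof; only the ENERGY transfer is in print; BEC can be boundary-condition sensitive.) [LSSY2005,
arXiv:2203.01841, arXiv:2205.15284, doi:10.1007/bf01608554]
#5 HardCoreExtension (crux) — (verbatim the statement of retired stmt-AtomisticToContinuum-6737,
re-filed) ground-state BEC at all small densities for every potential of the smooth class (finite,
C², finite range, ‖D²ṽ‖ ≤ Cₑ√ṽ) implies the conjunct for every repulsive finite-range potential
(hard cores, shells, kinks included); needed because Puff's cubic moment is +∞ for a hard core (m₃ ~
√V₀ for a step of height V₀) and log g needs a pointwise-positive minimiser. [difficulty: XL] (why
it might fail: no comparison or monotonicity of λ_max(γ) in v is known; approximating a hard core by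
class members v_n ↑ gives BEC with ρ₀(v_n), c(v_n) possibly → 0; Dyson's lemma transfers energies
only.) [LSSY2005, LiebSeiringerYngvason2005]
#9 PositiveMinimiser (support) — for every smooth-class v, every N = n+1 ≥ 1 and L > 0 the periodic
N-body energy has a minimiser in the C¹ periodic Bose class which is C³, has finite energy, and is
pointwise strictly positive (compact resolvent on the torus, Schauder regularity for V ∈ C², bosonic
ground state = absolute ground state, Perron–Frobenius / positivity improvement); N = 1: the
constant. [difficulty: L] [ReedSimonIV1978, LSSY2005]
#9 NearMinimiserStability (support) — (verbatim the statement of retired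
stmt-AtomisticToContinuum-6740, re-filed) at fixed N, L: for every ε > 0 there is δ > 0 such that
every δ-near-minimiser Φ has condensateOccupation ≥ that of a minimiser Ψ minus εN (discrete
spectrum and simple ground state by positivity improvement: ‖Φ − e^{iθ}Ψ‖² ≤ δ/gap; n₀ is
2N-Lipschitz on the unit sphere of L²); N = 0, 1 trivial. [difficulty: M] [ReedSimonIV1978,
LSSY2005]
#9 ShortDistanceCoherence (support) — (kinetic short-distance coherence, provable now) for every
periodic C¹ trial state Ψ of N = n+1 bosons on the torus of side L > 0 with finite kinetic energy T
= ∫_{cell^N}|∇Ψ|² and every r ∈ ℝ³: g(r) := ∫_cell∫_{cell^n}|Ψ(x+r,Y)||Ψ(x,Y)| ≥ 1 − |r|²T/(2N).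
Proof: 1 − Re∫∫Ψ(x+r,Y)Ψ̄(x,Y) = ½‖Ψ(·+r) − Ψ‖² ≤ ½|r|²∫|∇₁Ψ|² = |r|²T/2N by periodicity (the shift
preserves the cell measure), the fundamental theorem along the segment, Cauchy–Schwarz and Bose
symmetry. [difficulty: provable-now] [PitaevskiiStringari1991, LSSY2005]
#9 IMUChainGlue (support) — (glue of the thesis; kind glue) PositiveMinimiser →
NearMinimiserStability → ShortDistanceCoherence → PuffFloor → InfraredMinimumUncertainty →
SmoothPeriodicBEC. Bookkeeping for fixed smooth-class v: (i) n₀(Ψ)/N = V⁻¹∫_cell g for Ψ > 0 (unfold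
condensateOccupation, Fubini, substitute x' = x + r using periodicity); (ii) Jensen: log(V⁻¹∫g) ≥
V⁻¹∫log g = ĉ₀(log g) (g continuous, 0 < g ≤ 1); (iii) Parseval on the cell with φ = V·(η_κ∗η_κ), η
∈ C_c^∞(B_{1/2}), η ≥ 0, ∫η = 1, η_κ = κ³η(κ·), 1/κ < L/2: ĉ₀(log g) = V⁻¹∫φ log g − Σ_{m≠0}
|η̂(k/κ)|² ν_m; (iv) ShortDistanceCoherence + T ≤ periodicEnergy = E₀^per ≤ ρ‖ṽ‖₁N/2 (constant trial
state) give V⁻¹∫φ log g ≥ log(1 − ‖ṽ‖₁/4K²) with κ = K√ρ; (v) IMU + PuffFloor: ν_m ≤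
C₁√(|k|²+C₂ρ)/(N|k|), and the lattice sums Σ_m|η̂(k/κ)|² ≤ c_ηVκ³, Σ_{m≠0}|η̂(k/κ)|²/|k| ≤ c'_ηVκ²
(L ≥ 1/κ; d = 3 lattice-point counting) give Σ_{m≠0}|η̂|²ν_m ≤ C₁(c_ηK³ + c'_η√C₂K²)√ρ; (vi) choose
K² ≥ ‖ṽ‖₁, then ρ₀ small: n₀(Ψ) ≥ N/2 for the positive minimiser, and NearMinimiserStability with ε
= ¼ yields δ > 0 with n₀ ≥ N/4 for all δ-near-minimisers, i.e. SmoothPeriodicBEC with c = ¼.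
[difficulty: L] [Stringari1995, MoraCastin2003, LSSY2005]

TWO-LAYER PLAN. Foreseen glued splits (k ≤ 3, depth 1), filed only after a crux moves:
InfraredMinimumUncertainty ⇐ InfraredWindowIMU (Π_m ≤ C for |k| < K√ρ) →
UltravioletLevyTail ((ν_m)₊ ≤ C/(N S_m) for |k| ≥ K√ρ, where S → 1) → InfraredMinimumUncertainty;
alternatively the card's ENGINE K2:
InfraredMinimumUncertainty ⇐ SectorGapFloor (a Landau-type floor on the particle–hole sector gap,
cf. route BECSectorPoincareTwoScale) → StabilityTransfer
(ground-state stability ⟨A†(H−E₀)A⟩ ≥ 0 with A = a₀†a_k/√N, ρ_k, re-typed to bound ν_kS_k instead of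
n_k) → InfraredMinimumUncertainty.
PuffFloor ⇐ CubicMomentBound (M₃ ≤ N|k|⁴(|k|² + Θ), Θ = O(ρ): Puff's double commutator + edge
condition) → PairCountBound (E[#{i<j : |xᵢ−xⱼ| < R₀}] ≤ CNρR₀³
for the minimiser) → PuffFloor (glue: Hölder m₁² ≤ m₀m₂, m₂² ≤ m₁M₃). IMUChainGlue ⇐
LevyJensenParseval (steps i–iii) → LatticeKernelSums (step v) → IMUChainGlue.

KILL CRITERIA. ¬InfraredMinimumUncertainty (Π_m unbounded in N at small k for torus minimisers of
some smooth v at arbitrarily small ρ — it would also contradict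
Gavoret–Nozières pole sharing) closes the route: close --reason refuted:InfraredMinimumUncertainty.
¬PuffFloor (sub-linear S at small k, i.e.
hyperuniform-like minimisers, or clustering making Θ ≫ ρ) forces a pivot: a repaired item with Θ =
C(v)ρ^θ, θ > 0 (the glue tolerates any Θ with
√Θ·κ²/ρ → 0, i.e. θ > 0 after shrinking κ) — if S is genuinely sub-linear the line is dead. A
QMC/DMRG finding Π → ¼ FROM ABOVE kills only the card's
sharp QuarterLaw (not an item; recorded as negative knowledge on the card), not IMU.
¬HardCoreExtension: pivot the conclusion to the smooth class and
hand hard cores to a comparison route. ¬BoundaryTransferWeak kills every torus route's last step,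
not the mechanism. PeriodicBEC / SmoothPeriodicBEC
proved elsewhere moots items 0, 2, 3 and the supports; BoundaryTransferWeak proved elsewhere (two
other routes want it) shortens the chain.

NOT DECOMPOSED YET. The sharp constant (QuarterLaw: Π_m ≤ ¼ on |k| < K√ρ, the card's headline — a
falsifier, not load-bearing; may be filed as a rank-6 statement
once IMU moves); the IR/UV split of IMU and its engine (sector floor vs. direct variational proof);
the pair-count input of PuffFloor; the kernel
sums and the n₀ = (N/V)∫g identity inside IMUChainGlue (prover lemmas, --supports IMUChainGlue);
positivity/uniqueness facts behind
PositiveMinimiser; everything about the sign of ν (companion route BECInfDivCoherence — this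
assembly does not use it); d = 2, T > 0 and hard
cores (only via HardCoreExtension) are out of scope; no item asserts the compound-Poisson structure
of n_k.

CHEAPEST FALSIFIER. IMU / QuarterLaw on exact ground states: the half-filled XX ring (free fermions,
exactly solvable) — run by the card's author: Π₁ = 0.24583 (L=64),
0.24791 (128), 0.24896 (256), all below ¼ with deficit ∝ 1/L; 31 hard-core ED tori in d = 2, 3 and
Bose–Hubbard rings: max Π < ¼ (card P4,
56 instances, 0 violations). Next cheapest (kit, few node-hours): worm/PIGS QMC for 3D soft spheres,
N = 64–512, ρa³ = 10⁻⁴…10⁻²: Π at the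
10 smallest |k| (S(k) routine; ν_k from log G(r), noise enters linearly) — growth with N kills IMU,
an approach to ¼ from above kills only
QuarterLaw; and a Bogoliubov–LHY check that S(k) ≥ |k|/√(|k|²+Cρ) survives the LHY correction with C
= O(‖ṽ‖₁) (PuffFloor's constant).
Lookup falsifier: a printed converse of Pitaevskii–Stringari (9) — searched again this session
(Novelty), none found.

NUMBERS. Bogoliubov (ħ = 2m = 1, gn = 8πρa): Π(x) = 1/[2(2+x)(1+x+√(x²+2x))], x = k²/8πρa: Π(0⁺) =
¼, Π(1) = 1/(6(2+√3)) = 0.04466, Π ≈ 1/4x² UV;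
S(k) = k²/√(k⁴+16πρak²) = |k|/√(|k|²+16πρa) (PuffFloor with C = 16πa at Bogoliubov level); ν_k =
v_k²/N, Σ_k|k|²ν_k = T/N ≤ 4πρa(1+O(Y^{1/3})).
Harmonic (Luttinger/Bogoliubov) fixed point: N ν_k S_k = ¼ identically
(doi:10.1103/physrevlett.47.1840, audit AUDIT-37), so IMU's content is the
one-sided approach for the exact state. Card census: 56 instances, 0 violations of Π ≤ ¼;
half-filled rings L = 8…20: 0.2155…0.2366; XX chain
L = 64/128/256: 0.24583/0.24791/0.24896; two-body Wigner-molecule delimiter (outside the fluid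
regime): Π_max = 0.2530. Glue constants: κ = K√ρ,
K² ≥ ‖ṽ‖₁ gives V⁻¹∫φ log g ≥ log ¾; error C₁(c_ηK³ + c'_η√C₂K²)√ρ; f₀ ≥ ½ for the positive
minimiser, c = ¼ after stability. Items at open: 10
(4 cruxes, 1 target, 4 supports, 1 assembly); shared by signature: 0827 (open BECInfDivCoherence,
BECPhononFloor); re-filed verbatim from
retired routes (fresh ids): the statements of 6733, 6737, 6740.

DEFINITION REQUESTS. None needed at open: everything is inline over
Literature.MathematicalPhysics.QuantumManyBody.BoseGas.{PeriodicTrialState, periodicEnergy,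
periodicGroundStateEnergy, condensateOccupation, cell, cellN, cellWave, cellFourierCoeff,
latticeVec, sideLength, kineticDensity,
IsRepulsiveFiniteRange, HasGroundStateBEC, BoseEinsteinCondensation} (Sketch.lean rc 0; cone = real
definitions only, no named fact). Nice to
have later (would shorten items 2, 3 and the glue): levyWeight N L Ψ m, structureFactor N L Ψ m,
averagedDensityMatrix N L Ψ r in
Literature/MathematicalPhysics/QuantumManyBody.

Novelty: Searches (2026-08-15, this seat, on top of the card's three refuter audits): `lit search --hybrid
"uncertainty inequality momentum distribution
static structure factor Bose superfluid upper bound phase fluctuations"` (12 held books: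
Griffin1993, Stringari1995 ch. pp. 49/74, LSSY2005,
Lipparini2008 p. 464 — lower side / Puff m₃ only); `lit vsearch` on the IMU statement in prose (10
books: Griffin1993 p. 189, Stringari1995
pp. 49, 74, 82, Pethick–Smith, Altland–Simons — Gaussian/Bogoliubov level, no converse inequality);
`lit galaxy search --star all "uncertainty
relation structure factor momentum distribution Bose"` (0 rows) and `"Uncertainty principle, quantum
fluctuations, and broken symmetries"`
(4 rows: arXiv:2403.00421, arXiv:2408.13145, EPFL thesis 5205 — all cite PitaevskiiStringari1991 for
the LOWER-side exclusion in low d);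
`lit frontier AtomisticToContinuum --since 2022` (30 descendants: arXiv:2510.20493, 2603.20776,
2605.06844 … energy/Neumann localisation,
none sum-rule or Lévy based); card audits AUDIT-26/35/37 (galaxy pdf bm25, Crossref/zbMATH sweeps):
nothing states ν_k ≤ C/(N S(k)).
Nearest prior art found: PitaevskiiStringari1991 (doi:10.1007/bf00682193) / Stringari1995 §2.2
(9)–(11) — the REVERSE inequality
n(q) ≥ n₀/4S(q) − ½ with n₀ inside; doi:10.1103/physrevlett.47.1840 (Haldane 1981: N ν S = ¼
identically at the harmonic fixed point);
Puff1965 / doi:10.1103/physrevb.46.2974 (cubic moment, used there for UPPER bounds on excitation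
energies); GavoretNozier  [refs: 10.1007/bf00682193, 10.1103/physrevlett.47.1840, 10.1103/physrevb.46.2974, 2403.00421, 2408.13145, 2510.20493, doi:10.1007/bf00682193, doi:10.1103/physrevlett.47.1840, doi:10.1103/physrevb.46.2974, Griffin1993, Stringari1995, LSSY2005, PitaevskiiStringari1991, Puff1965, GavoretNozieres1964]

Barriers (technique_class: conjugate-domination, Levy-weight, sum-rules): - technique_class: conjugate-domination, Levy-weight, sum-rules
- Literature.Barriers.AtomisticToContinuum.PitaevskiiStringariOneDimension: IMU and PuffFloor are
dimension-blind and TRUE in d = 1 (XX chain saturates Π → ¼ from below); the barrier's content is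
relocated exactly into the glue's lattice sum Σ_{m≠0}φ̂(k)/|k| ≍ Vκ² in d = 3 (≍ ∫_{|k|<κ}d^dk/|k|,
finite iff d ≥ 2; in d = 1 it is the Luttinger logarithm and the chain concludes nothing) — evaded
structurally, in step (v) of IMUChainGlue, not by an estimate insensitive to d.
- Literature.Barriers.AtomisticToContinuum.PitaevskiiStringariOneDimensionNarrow: clause (ii) of the
audit names the one admissible evasion — the infrared summability L^{−d}Σ_{0<|k|≤κL}L/|k| = O(1) ⇔ d
≥ 2 — and that is literally step (v) of IMUChainGlue; consistent with clause (1): both cruxes hold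
in d = 1 where the same sum is the log L/K depletion.
- Literature.Barriers.AtomisticToContinuum.OneDimensionalHardCore: Girardeau's impenetrable ring gas
has IMU saturated (Π → ¼ from below, card census on the XX chain) and no BEC — consistent, because
the glue's Lévy-mass count diverges logarithmically in d = 1; nothing in the chain is a
dimension/coupling-independent trial-function argument.
- Literature.Barriers.AtomisticToContinuum.OneDimensionalHardCoreNarrow: "valid verbatim for the
impenetrable 1D gas" is the dividing line; the cruxes are stated for d = 3 smooth-class minimisers
and the glue uses d = 3 lattice-point counting explicitly, so the

History (route lifecycle, newest last):
- 2026-08-24T23:45:32Z · DORMANT — reconciler: no traction for 7.2 d (last activity item-evidence-added at 2026-08-17T18:55:01Z); parked, not closed — `ledger route dormant route-AtomisticToConti (operator:999:1293303)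

sub-problem: BoseEinsteinCondensation · status: dormant · opened planner-plancard-AtomisticToContinuum-BoseEin-9a5bb403-g2-0 2026-08-15T18:43:03Z · rev 2 · ledger route-AtomisticToContinuum-BECConjugateDomination
GENERATED by the gate from the ledger (D-0016/17). Provers cite these decls: `theorem foo : Summit.AtomisticToContinuum.BoseEinsteinCondensation.Theses.BECConjugateDomination.<Decl> := …` in Summits/AtomisticToContinuum/BoseEinsteinCondensation/Theorems/<Name>.lean.
-/

namespace Summit.AtomisticToContinuum.BoseEinsteinCondensation.Theses.BECConjugateDomination

open scoped BigOperators Topology Manifold Classical MeasureTheory ProbabilityTheory Matrix InnerProductSpace ComplexConjugate ContinuousMap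
open Filter Set Function TopologicalSpace MeasureTheory

attribute [summit_statement] _root_.BoseEinsteinCondensation

/-- item stmt-AtomisticToContinuum-11783 · target · rank 0 · open · by planner
why it might fail: It is thermodynamic-limit ground-state BEC on the torus (N→∞ at fixed small ρ) for smooth potentials — open (LSSY2005 Ch. 5); all rigorous condensation proofs run through the kinetic gap and stop at boxes L ≲ a(ρa³)^(−3/4−η) (Fournais2020 Thm 1.2, Junge2026 Cor. 6), barrier KineticGapLengthScales.
sources: LSSY2005, Fournais2020, Junge2026, ChongLiangNam2026, Literature.Barriers.AtomisticToContinuum.KineticGapLengthScales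
[target] (verbatim the statement of stmt-AtomisticToContinuum-6733 of the retired route
BECSumRuleBootstrap, re-filed) PeriodicBEC restricted to the smooth class: for every repulsive
finite-range v that is finite, C² as ṽ(x) = v(|x|) on ℝ³, with ‖D²ṽ‖ ≤ Cₑ√ṽ, there is ρ₀ > 0 such
that for 0 < ρ < ρ₀ there is c > 0 with: for all large N there is δ > 0 such that every periodic
trial state on the torus of side (N/ρ)^{1/3} with periodicEnergy ≤ E₀^per + δ has constant-mode
occupation ≥ cN. It is what X delivers through IMUChainGlue. -/
@[route_item "route-AtomisticToContinuum-BECConjugateDomination"]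
def SmoothPeriodicBEC : Prop :=
  open Literature.MathematicalPhysics.QuantumManyBody.BoseGas in ∀ v : ℝ → ENNReal, IsRepulsiveFiniteRange v → (∀ r, v r ≠ ⊤) → ContDiff ℝ 2 (fun x : Space => (v ‖x‖).toReal) → (∃ Cₑ : ℝ, ∀ x : Space, ‖iteratedFDeriv ℝ 2 (fun x : Space => (v ‖x‖).toReal) x‖ ≤ Cₑ * Real.sqrt ((v ‖x‖).toReal)) → ∃ ρ₀ : ℝ, 0 < ρ₀ ∧ ∀ ρ : ℝ, 0 < ρ → ρ < ρ₀ → ∃ c : ℝ, 0 < c ∧ ∀ᶠ N : ℕ in Filter.atTop, ∃ δ : ENNReal, 0 < δ ∧ ∀ Ψ : PeriodicTrialState N (sideLength ρ N), periodicEnergy v Ψ ≤ periodicGroundStateEnergy v N (sideLength ρ N) + δ → ENNReal.ofReal (c * N) ≤ condensateOccupation N (sideLength ρ N) Ψ.ψ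

/-- item stmt-AtomisticToContinuum-11784 · crux · rank 2 · open · by planner
why it might fail: n₀-free converse of Pitaevskii–Stringari (9): where S_k ≈ |k|/2mc it forces ν_k ≲ 2mcC/(N|k|), the 1/|k| law from ABOVE — an infrared bound as strong as BEC; a log(kξ) dressing of ν_k at the lowest modes (Gavoret–Nozières/Nepomnyashchii, d=3 marginal) or C(ρ)↑∞ as ρ→0 breaks ∃C ∀ρ<ρ₀ ∀ᶠN.
sources: Stringari1995, PitaevskiiStringari1991, GavoretNozieres1964, NepomnyashchiiNepomnyashchii1978, Griffin1993, MoraCastin2003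
[crux] (card K1, bounded load-bearing form, all modes) for every smooth-class v there are C ≥ 0 and
ρ₀ > 0 such that for 0 < ρ < ρ₀, all large N = n+1 and every positive minimiser Ψ of the periodic
N-body energy on the torus of side L = (N/ρ)^{1/3} (periodicEnergy = E₀^per < ∞, Ψ > 0 pointwise),
for every m ∈ ℤ³∖0: N·ν_m·S_m ≤ C, where g(r) = ∫_cell∫_{cell^n} Ψ(x+r,Y)Ψ(x,Y), ν_m = Re
cellFourierCoeff(log g)(m), S_m = N⁻¹∫|Σ_j e_m(x_j)|²Ψ². Bogoliubov: C = ¼ works at every k;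
Gavoret–Nozières + phonon saturation of S: Π → ¼ as k → 0; v ≡ 0: g ≡ 1, ν = 0, holds with C = 0.
[difficulty: open-problem] -/
@[route_item "route-AtomisticToContinuum-BECConjugateDomination", crux]
def InfraredMinimumUncertainty : Prop :=
  open Literature.MathematicalPhysics.QuantumManyBody.BoseGas in ∀ v : ℝ → ENNReal, IsRepulsiveFiniteRange v → (∀ r, v r ≠ ⊤) → ContDiff ℝ 2 (fun x : Space => (v ‖x‖).toReal) → (∃ Cₑ : ℝ, ∀ x : Space, ‖iteratedFDeriv ℝ 2 (fun x : Space => (v ‖x‖).toReal) x‖ ≤ Cₑ * Real.sqrt ((v ‖x‖).toReal)) → ∃ C : ℝ, 0 ≤ C ∧ ∃ ρ₀ : ℝ, 0 < ρ₀ ∧ ∀ ρ : ℝ, 0 < ρ → ρ < ρ₀ → ∀ᶠ n : ℕ in Filter.atTop, ∀ Ψ : PeriodicTrialState (n + 1) (sideLength ρ (n + 1)), (let L : ℝ := sideLength ρ (n + 1); let g : Space → ℝ := fun r => ∫ x in cell L, ∫ Y in cellN n L, ‖Ψ.ψ (Matrix.vecCons (x + r) Y)‖ * ‖Ψ.ψ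 (Matrix.vecCons x Y)‖; let ν : (Fin 3 → ℤ) → ℝ := fun m => (cellFourierCoeff L (fun r : Space => ((Real.log (g r) : ℝ) : ℂ)) m).re; let S : (Fin 3 → ℤ) → ℝ := fun m => ((n : ℝ) + 1)⁻¹ * ∫ X in cellN (n + 1) L, ‖∑ j : Fin (n + 1), cellWave L m (X j)‖ ^ 2 * ‖Ψ.ψ X‖ ^ 2; periodicEnergy v Ψ = periodicGroundStateEnergy v (n + 1) L → periodicEnergy v Ψ ≠ ⊤ → (∀ X, Ψ.ψ X = (‖Ψ.ψ X‖ : ℂ)) → (∀ X, Ψ.ψ X ≠ 0) → ∀ m : Fin 3 → ℤ, m ≠ 0 → ((n : ℝ) + 1) * ν m * S m ≤ C)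

/-- item stmt-AtomisticToContinuum-11785 · crux · rank 3 · closed · proved by Summit.AtomisticToContinuum.BoseEinsteinCondensation.Theorems.PuffFloor_proof @ 99d40450dfc6 (prover) · by planner
why it might fail: Hölder m₀ ≥ m₁^(3/2)m₃^(−1/2) needs Puff's m₃ ≤ N|k|⁴(|k|²+Θ), Θ = O(ρ) uniformly in N; its term ρ∫(1−cos kz)g₂∂z²V (Stringari1995 (22)) is controlled by energy only via ∫g₂v — pairs in the soft edge of supp v (D²ṽ ~ √ṽ ≫ ṽ) need a no-clustering bound E#{|xᵢ−xⱼ|<R₀} ≤ CNρR₀³ not in print.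
sources: Puff1965, Stringari1995, doi:10.1103/physrevb.46.2974, Feynman1954, LiebYngvason1998, LSSY2005
[crux] (card P1′(a), linear anti-hyperuniformity floor) for every smooth-class v there are C ≥ 0, ρ₀
> 0 such that for 0 < ρ < ρ₀, all large N and every positive minimiser Ψ on the torus of side
(N/ρ)^{1/3}, for every m ≠ 0 with k = 2πm/L: S_m ≥ |k|/√(|k|² + Cρ). Intended proof: m₀ ≥
m₁^{3/2}M₃^{−1/2} (Hölder twice on the spectral measure of H − E₀ in the vector ρ_k†Ψ, which is
supported on [0,∞) because Ψ is the minimiser), f-sum m₁ = N|k|² (units ħ = 2m = 1), and Puff's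
cubic moment M₃ ≤ N|k|⁴(|k|² + c₁T/N + c₂E_Ψ[Σ_{i<j}|x_i−x_j|²|D²ṽ(x_i−x_j)|]/N) with both brackets
O(ρ) (edge condition + energy); Bogoliubov: C = 16πa; v ≡ 0: S_m = 1. [difficulty: L] -/
@[route_item "route-AtomisticToContinuum-BECConjugateDomination", crux]
def PuffFloor : Prop :=
  open Literature.MathematicalPhysics.QuantumManyBody.BoseGas in ∀ v : ℝ → ENNReal, IsRepulsiveFiniteRange v → (∀ r, v r ≠ ⊤) → ContDiff ℝ 2 (fun x : Space => (v ‖x‖).toReal) → (∃ Cₑ : ℝ, ∀ x : Space, ‖iteratedFDeriv ℝ 2 (fun x : Space => (v ‖x‖).toReal) x‖ ≤ Cₑ * Real.sqrt ((v ‖x‖).toReal)) → ∃ C : ℝ, 0 ≤ C ∧ ∃ ρ₀ : ℝ, 0 < ρ₀ ∧ ∀ ρ : ℝ, 0 < ρ → ρ < ρ₀ → ∀ᶠ n : ℕ in Filter.atTop, ∀ Ψ : PeriodicTrialState (n + 1) (sideLength ρ (n + 1)), (let L : ℝ := sideLength ρ (n + 1); let S : (Fin 3 → ℤ) → ℝ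 := fun m => ((n : ℝ) + 1)⁻¹ * ∫ X in cellN (n + 1) L, ‖∑ j : Fin (n + 1), cellWave L m (X j)‖ ^ 2 * ‖Ψ.ψ X‖ ^ 2; let kn : (Fin 3 → ℤ) → ℝ := fun m => ‖((2 * Real.pi / L) • latticeVec 1 m)‖; periodicEnergy v Ψ = periodicGroundStateEnergy v (n + 1) L → periodicEnergy v Ψ ≠ ⊤ → (∀ X, Ψ.ψ X = (‖Ψ.ψ X‖ : ℂ)) → (∀ X, Ψ.ψ X ≠ 0) → ∀ m : Fin 3 → ℤ, m ≠ 0 → kn m / Real.sqrt (kn m ^ 2 + C * ρ) ≤ S m)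

/-- item stmt-AtomisticToContinuum-0827 · crux · rank 4 · open · by planner
why it might fail: PeriodicBEC(v) is ground-state-only (δ after N); the Dirichlet ground state lies a wall term ≫ δ above E₀^per, so no energy-comparison proof; only the ENERGY transfer is in print; BEC can be boundary-condition sensitive.
sources: LSSY2005, arXiv:2203.01841, arXiv:2205.15284, doi:10.1007/bf01608554
[crux] BoundaryTransferWeak (mode-free boundary-condition transfer, per potential): for each
repulsive finite-range v, PeriodicBEC(v) implies ∃ρ₀>0 ∀ρ∈(0,ρ₀) HasGroundStateBEC v ρ (Dirichlet
ground state, λ_max(γ) ≥ cN via condensateNumber). Not glue: near-minimiser slacks are O(N/L²) while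
Dirichlet/periodic energies differ by a boundary term ≫ N/L², so no energy-comparison proof;
expected route: Neumann bracketing of interior sub-boxes (−Δ_Dir ≥ ⊕−Δ_Neu, v ≥ 0) + a mode-free
criterion (λ_max ≥ tr γ²/N). Only the ENERGY analogue is in print (LiebSeiringerSolovejYngvason2005
Ch. 2 after (2.8)). v ≡ 0: hypothesis and conclusion both true. -/
@[route_item "route-AtomisticToContinuum-BECConjugateDomination", crux]
def BoundaryTransferWeak : Prop :=
  ∀ v : ℝ → ENNReal, Literature.MathematicalPhysics.QuantumManyBody.BoseGas.IsRepulsiveFiniteRange v → (∃ ρ₀ : ℝ, 0 < ρ₀ ∧ ∀ ρ : ℝ, 0 < ρ → ρ < ρ₀ → ∃ c : ℝ, 0 < c ∧ ∀ᶠ N : ℕ in Filter.atTop, ∃ δ : ENNReal, 0 < δ ∧ ∀ Ψ : Literature.MathematicalPhysics.QuantumManyBody.BoseGas.PeriodicTrialState N (Literature.MathematicalPhysics.QuantumManyBody.BoseGas.sideLength ρ N), Literature.MathematicalPhysics.QuantumManyBody.BoseGas.periodicEnergy v Ψ ≤ Literature.MathematicalPhysics.QuantumManyBody.BoseGas.periodicGroundStateEnergy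 v N (Literature.MathematicalPhysics.QuantumManyBody.BoseGas.sideLength ρ N) + δ → ENNReal.ofReal (c * N) ≤ Literature.MathematicalPhysics.QuantumManyBody.BoseGas.condensateOccupation N (Literature.MathematicalPhysics.QuantumManyBody.BoseGas.sideLength ρ N) Ψ.ψ) → ∃ ρ₀ : ℝ, 0 < ρ₀ ∧ ∀ ρ : ℝ, 0 < ρ → ρ < ρ₀ → Literature.MathematicalPhysics.QuantumManyBody.BoseGas.HasGroundStateBEC v ρ

/-- item stmt-AtomisticToContinuum-11786 · crux · rank 5 · open · by planner
why it might fail: An implication between two open statements with no mechanism: λ_max(γ_Ψ) has no known monotonicity or continuity in v; Dyson's lemma / Lieb–Yngvason trade hard core ↔ soft potential only inside ENERGY lower bounds; smooth-class vₙ ↑ ∞·1_{r<a} may give ρ₀(vₙ), c(vₙ) → 0 (ρ_c < ∞ only for hard cores).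
sources: LSSY2005, Dyson1957, LiebYngvason1998, Literature.MathematicalPhysics.QuantumManyBody.BoseGas.criticalDensity_eq_top_of_noHardCore
[crux] (verbatim the statement of retired stmt-AtomisticToContinuum-6737, re-filed) ground-state BEC
at all small densities for every potential of the smooth class (finite, C², finite range, ‖D²ṽ‖ ≤
Cₑ√ṽ) implies the conjunct for every repulsive finite-range potential (hard cores, shells, kinks
included); needed because Puff's cubic moment is +∞ for a hard core (m₃ ~ √V₀ for a step of height
V₀) and log g needs a pointwise-positive minimiser. [difficulty: XL] -/
@[route_item "route-AtomisticToContinuum-BECConjugateDomination", crux]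
def HardCoreExtension : Prop :=
  open Literature.MathematicalPhysics.QuantumManyBody.BoseGas in (∀ v : ℝ → ENNReal, IsRepulsiveFiniteRange v → (∀ r, v r ≠ ⊤) → ContDiff ℝ 2 (fun x : Space => (v ‖x‖).toReal) → (∃ Cₑ : ℝ, ∀ x : Space, ‖iteratedFDeriv ℝ 2 (fun x : Space => (v ‖x‖).toReal) x‖ ≤ Cₑ * Real.sqrt ((v ‖x‖).toReal)) → ∃ ρ₀ : ℝ, 0 < ρ₀ ∧ ∀ ρ : ℝ, 0 < ρ → ρ < ρ₀ → HasGroundStateBEC v ρ) → Literature.MathematicalPhysics.QuantumManyBody.BoseGas.BoseEinsteinCondensation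

/-- item stmt-AtomisticToContinuum-11787 · support · rank 9 · closed · proved by Summit.AtomisticToContinuum.BoseEinsteinCondensation.Theorems.PositiveMinimiser_proof (prover) · by planner
sources: ReedSimonIV1978, LSSY2005
[support] for every smooth-class v, every N = n+1 ≥ 1 and L > 0 the periodic N-body energy has a
minimiser in the C¹ periodic Bose class which is C³, has finite energy, and is pointwise strictly
positive (compact resolvent on the torus, Schauder regularity for V ∈ C², bosonic ground state =
absolute ground state, Perron–Frobenius / positivity improvement); N = 1: the constant. [difficulty:
L] -/
@[route_item "route-AtomisticToContinuum-BECConjugateDomination", crux]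
def PositiveMinimiser : Prop :=
  open Literature.MathematicalPhysics.QuantumManyBody.BoseGas in ∀ v : ℝ → ENNReal, IsRepulsiveFiniteRange v → (∀ r, v r ≠ ⊤) → ContDiff ℝ 2 (fun x : Space => (v ‖x‖).toReal) → (∃ Cₑ : ℝ, ∀ x : Space, ‖iteratedFDeriv ℝ 2 (fun x : Space => (v ‖x‖).toReal) x‖ ≤ Cₑ * Real.sqrt ((v ‖x‖).toReal)) → ∀ n : ℕ, ∀ L : ℝ, 0 < L → ∃ Ψ : PeriodicTrialState (n + 1) L, periodicEnergy v Ψ = periodicGroundStateEnergy v (n + 1) L ∧ periodicEnergy v Ψ ≠ ⊤ ∧ ContDiff ℝ 3 Ψ.ψ ∧ (∀ X, Ψ.ψ X = (‖Ψ.ψ X‖ : ℂ)) ∧ (∀ X, Ψ.ψ X ≠ 0)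

/-- item stmt-AtomisticToContinuum-11788 · support · rank 9 · closed · proved by Summit.AtomisticToContinuum.BoseEinsteinCondensation.Theorems.nearMinimiserStability_proof (prover) · by planner
sources: ReedSimonIV1978, LSSY2005
[support] (verbatim the statement of retired stmt-AtomisticToContinuum-6740, re-filed) at fixed N,
L: for every ε > 0 there is δ > 0 such that every δ-near-minimiser Φ has condensateOccupation ≥ that
of a minimiser Ψ minus εN (discrete spectrum and simple ground state by positivity improvement: ‖Φ −
e^{iθ}Ψ‖² ≤ δ/gap; n₀ is 2N-Lipschitz on the unit sphere of L²); N = 0, 1 trivial. [difficulty: M] -/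
@[route_item "route-AtomisticToContinuum-BECConjugateDomination", crux]
def NearMinimiserStability : Prop :=
  open Literature.MathematicalPhysics.QuantumManyBody.BoseGas in ∀ v : ℝ → ENNReal, IsRepulsiveFiniteRange v → (∀ r, v r ≠ ⊤) → ContDiff ℝ 2 (fun x : Space => (v ‖x‖).toReal) → (∃ Cₑ : ℝ, ∀ x : Space, ‖iteratedFDeriv ℝ 2 (fun x : Space => (v ‖x‖).toReal) x‖ ≤ Cₑ * Real.sqrt ((v ‖x‖).toReal)) → ∀ N : ℕ, ∀ L : ℝ, 0 < L → periodicGroundStateEnergy v N L ≠ ⊤ → ∀ ε : ℝ, 0 < ε → ∃ δ : ENNReal, 0 < δ ∧ ∀ Ψ Φ : PeriodicTrialState N L, periodicEnergy v Ψ = periodicGroundStateEnergy v N L → periodicEnergy v Φ ≤ periodicGroundStateEnergy v N L + δ → condensateOccupation N L Ψ.ψ ≤ condensateOccupation N L Φ.ψ + ENNReal.ofReal (ε * N)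

/-- item stmt-AtomisticToContinuum-11789 · support · rank 9 · closed · proved by Summit.AtomisticToContinuum.BoseEinsteinCondensation.Theorems.shortDistanceCoherence_proof (prover) · by planner
sources: PitaevskiiStringari1991, LSSY2005
[support] (kinetic short-distance coherence, provable now) for every periodic C¹ trial state Ψ of N
= n+1 bosons on the torus of side L > 0 with finite kinetic energy T = ∫_{cell^N}|∇Ψ|² and every r ∈
ℝ³: g(r) := ∫_cell∫_{cell^n}|Ψ(x+r,Y)||Ψ(x,Y)| ≥ 1 − |r|²T/(2N). Proof: 1 − Re∫∫Ψ(x+r,Y)Ψ̄(x,Y) =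
½‖Ψ(·+r) − Ψ‖² ≤ ½|r|²∫|∇₁Ψ|² = |r|²T/2N by periodicity (the shift preserves the cell measure), the
fundamental theorem along the segment, Cauchy–Schwarz and Bose symmetry. [difficulty: provable-now] -/
@[route_item "route-AtomisticToContinuum-BECConjugateDomination", crux]
def ShortDistanceCoherence : Prop :=
  open Literature.MathematicalPhysics.QuantumManyBody.BoseGas in ∀ n : ℕ, ∀ L : ℝ, 0 < L → ∀ Ψ : PeriodicTrialState (n + 1) L, (∫⁻ X in cellN (n + 1) L, kineticDensity Ψ.ψ X) ≠ ⊤ → ∀ r : Space, 1 - ‖r‖ ^ 2 * (∫⁻ X in cellN (n + 1) L, kineticDensity Ψ.ψ X).toReal / (2 * ((n : ℝ) + 1)) ≤ ∫ x in cell L, ∫ Y in cellN n L, ‖Ψ.ψ (Matrix.vecCons (x + r) Y)‖ * ‖Ψ.ψ (Matrix.vecCons x Y)‖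

/-- item stmt-AtomisticToContinuum-11790 · support · rank 9 · closed · proved by Summit.AtomisticToContinuum.BoseEinsteinCondensation.Theorems.imuChainGlue_proof (prover) · by planner
sources: Stringari1995, MoraCastin2003, LSSY2005
[support] (glue of the thesis; kind glue) PositiveMinimiser → NearMinimiserStability →
ShortDistanceCoherence → PuffFloor → InfraredMinimumUncertainty → SmoothPeriodicBEC. Bookkeeping for
fixed smooth-class v: (i) n₀(Ψ)/N = V⁻¹∫_cell g for Ψ > 0 (unfold condensateOccupation, Fubini,
substitute x' = x + r using periodicity); (ii) Jensen: log(V⁻¹∫g) ≥ V⁻¹∫log g = ĉ₀(log g) (g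
continuous, 0 < g ≤ 1); (iii) Parseval on the cell with φ = V·(η_κ∗η_κ), η ∈ C_c^∞(B_{1/2}), η ≥ 0,
∫η = 1, η_κ = κ³η(κ·), 1/κ < L/2: ĉ₀(log g) = V⁻¹∫φ log g − Σ_{m≠0} |η̂(k/κ)|² ν_m; (iv)
ShortDistanceCoherence + T ≤ periodicEnergy = E₀^per ≤ ρ‖ṽ‖₁N/2 (constant trial state) give V⁻¹∫φ
log g ≥ log(1 − ‖ṽ‖₁/4K²) with κ = K√ρ; (v) IMU + PuffFloor: ν_m ≤ C₁√(|k|²+C₂ρ)/(N|k|), and the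
lattice sums Σ_m|η̂(k/κ)|² ≤ c_ηVκ³, Σ_{m≠0}|η̂(k/κ)|²/|k| ≤ c'_ηVκ² (L ≥ 1/κ; d = 3 lattice-point
counting) give Σ_{m≠0}|η̂|²ν_m ≤ C₁(c_ηK³ + c'_η√C₂K²)√ρ; (vi) choose K² ≥ ‖ṽ‖₁, then ρ₀ small:
n₀(Ψ) ≥ N/2 for the positive minimiser, and NearMinimiserStability with ε = ¼ yields δ > 0 with n₀ ≥
N/4 for all δ-near-minimisers, i.e. SmoothPeriodicBEC with c = ¼. [difficulty: L] -/
@[route_item "route-AtomisticToContinuum-BECConjugateDomination", crux]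
def IMUChainGlue : Prop :=
  PositiveMinimiser → NearMinimiserStability → ShortDistanceCoherence → PuffFloor → InfraredMinimumUncertainty → SmoothPeriodicBEC

/-- item stmt-AtomisticToContinuum-11791 · assembly · rank 1 · closed · proved by Summit.AtomisticToContinuum.BoseEinsteinCondensation.Theorems.becConjugateDomination_assembly_proof @ a2447a268549 (prover) · by planner
sources: LSSY2005, Stringari1995
[assembly] InfraredMinimumUncertainty → PuffFloor → BoundaryTransferWeak → HardCoreExtension →
PositiveMinimiser → NearMinimiserStability → ShortDistanceCoherence → IMUChainGlue →
BoseEinsteinCondensation (the sub-problem Statement decl). -/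
@[route_item "route-AtomisticToContinuum-BECConjugateDomination"]
def Assembly : Prop :=
  InfraredMinimumUncertainty → PuffFloor → BoundaryTransferWeak → HardCoreExtension → PositiveMinimiser → NearMinimiserStability → ShortDistanceCoherence → IMUChainGlue → BoseEinsteinCondensation

/-! D-0027 §2.1 — DECIDING THEOREM (planner-authored via `route open/edit --closes-file`; by planner-plancard-AtomisticToContinuum-BoseEin-9a5bb403-g2-0 2026-08-15T18:43:04Z):
its hypotheses are this route's items and its conclusion the sub-problem Statement (glue_lint), and it elaborates with this file. -/

@[closes "route-AtomisticToContinuum-BECConjugateDomination"] theorem closes (h₁ : InfraredMinimumUncertainty) (h₂ : PuffFloor) (h₃ : BoundaryTransferWeak)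
    (h₄ : HardCoreExtension) (h₅ : PositiveMinimiser) (h₆ : NearMinimiserStability)
    (h₇ : ShortDistanceCoherence) (h₈ : IMUChainGlue) : BoseEinsteinCondensation :=
  h₄ (fun v a b c d => h₃ v a (h₈ h₅ h₆ h₇ h₂ h₁ v a b c d))

end Summit.AtomisticToContinuum.BoseEinsteinCondensation.Theses.BECConjugateDomination
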